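import Summits.CriticalPhenomena.CardyFormulaZ2.Theorems.CardyIKTransportCrudeToCanonical

/-!
# Line `registered`, stub 1: a G02 crossing is a crude crossing (`stub_discrete_le_crude`)

Crux `Summit.CriticalPhenomena.CardyFormulaZ2.Theses.CardyBondTriangular.DiscretisationBridge`
(stmt-CriticalPhenomena-0787, shared with `…CardyIsoradial.DiscretisationBridge`), line
`registered`, stub `stub_discrete_le_crude`: for every conformal rectangle `R` and mesh `δ > 0`,
G02's crossing probability `bondDomainCrossingProb R δ` (open crossing of the largest mesh
component `Ω_δ` between the distance-comparison discrete arcs) is at most the `P_{1/2}`-probability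
of the crude embedded crossing event of `squareLatticeEmbedding` at parameter `δ/√2` (open path
with all vertices in `Ω` from within `√2 δ` of `R.arc 0` to within `√2 δ` of `R.arc 2`; the
lattice `(δ/√2)·√2·ℤ² = δℤ²` is the same). This is exactly the tree's
`bondDomainCrossingProb_le_crude` (`CardyIKTransportCrudeToCanonical.lean`: discrete-arc vertices
lie within `δ ≤ √2 δ` of their arc and paths of `Ω_δ` have their vertices in `Ω`).

References: S. Smirnov, C. R. Acad. Sci. Paris 333 (2001), §2; B. Bollobás, O. Riordan,
*Percolation* (2006), Ch. 7, remark p. 195.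
-/

namespace Summit.CriticalPhenomena.CardyFormulaZ2.Cruxes.DiscretisationBridge.Birth

/-- **Stub 1 of line `registered` (deterministic inclusion G02 ⊆ crude).** For every conformal
rectangle and every mesh `δ > 0`, G02's crossing probability at mesh `δ` is at most the crude
embedded crossing probability at crude parameter `δ/√2` (same vertex positions `δℤ²`): every open
`Ω_δ`-path from `(ab)_δ` to `(cd)_δ` is an open `ℤ²`-path with vertices in `Ω` whose endpoints are
within `δ ≤ √2·δ = 2·(δ/√2)` of the continuous arcs (tree: `bondDomainCrossingProb_le_crude`).
[cite: Smirnov2001, §2] [cite: BollobasRiordan2006, Ch. 7 remark p. 195] -/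
theorem stub_discrete_le_crude :
    ∀ (R : Literature.Probability.RandomPlanarGeometry.ConformalRectangle) (δ : ℝ), 0 < δ →
      Literature.Probability.Percolation.bondDomainCrossingProb R δ ≤
        (Literature.Probability.Percolation.bondPercolation
            (Literature.Probability.LatticeModels.zdGraph 2)
            Literature.Probability.Percolation.half).real
          (Literature.Probability.Percolation.embDomainCrossing
            Literature.Probability.LatticeModels.squareLatticeEmbedding.z R.carrier
            (δ / Real.sqrt 2) (R.arc 0) (R.arc 2)) :=
  fun R _ hδ => Summit.CriticalPhenomena.CardyFormulaZ2.Theorems.bondDomainCrossingProb_le_crude R hδ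

end Summit.CriticalPhenomena.CardyFormulaZ2.Cruxes.DiscretisationBridge.Birth
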